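import Literature.NumberTheory.Automorphic.HidaEngineModules
import Literature.NumberTheory.Automorphic.HidaLatticeDiamondAction
import Literature.NumberTheory.Automorphic.LevelActionHeckeMultiplicative
import HarnessLib

/-!
# Commutativity of the Hecke operators of the symbols in the coefficients-at-`p` model

Topic `NumberTheory/Automorphic`; namespaces `Literature.NumberTheory.Automorphic.LevelAction`
(generic), `Literature.NumberTheory.Automorphic.BigHeckeGLn` (elements) and
`Literature.NumberTheory.Automorphic.BigHeckeGLn.TameLevel`; definitions with bodies (the operator
family of the symbols, its polynomial action, the `U_p`-ordinary part) and theorems; no named fact,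
no `sorry`.

For the levelwise support argument of Hida's control theorem
([Hida1994AIF, §3, proof of Thm 3.2]; [KhareThorne2017, §6.5, Lemma 6.17]) the symbol ring
`O[Syms]` of `HidaEngineSymbols` (good Hecke elements `t_{w,j}`, `w ∉ S`, and the torus elements of
global torus data) must act on the cohomology `H^i(U(b,c), τ)` of the COEFFICIENTS-AT-`p` model
(`LevelAction`, e.g. `τ = ⨂_τ Sym^{k−2}` on the integral monoid) through pairwise COMMUTING
operators.  This file proves the commutativity ([KhareThorne2017, §6.2, Lemma 6.5 (1)]) for an
arbitrary coefficient system `τ : Δ → End V` on a Hecke monoid `Δ ⊇ U(b,c)`: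

* generic (`LevelAction`): `heckeOp_apply_eq_sum_local'`, `heckeOp_comm_apply_of_orthogonal'` — the
  local double-coset sum and the commutation of operators at two orthogonal unramified places of
  `IntegralWeightHeckeModuleGL2`, with the hypothesis `ι_v(G_v) ⊆ Δ` weakened to `ι_v(a) ∈ Δ`
  (needed at the places above `p`, where only the integral matrices lie in `Δ`);
  `heckeCohomology_comm_of_central`;
* for the Hida levels `U(b,c)` (`U` maximal above `p`): operators at distinct Hida places commute
  (`heckeCohomology_level_comm_of_ne`), `T(t_{w,j})` and `T(t_{w,j'})` commute
  (`heckeCohomology_level_comm_heckeElement`), hence **the operators of the symbols pairwise commute**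
  (`symOp_comm`) and commute with the `U_{v,1}`, `v ∣ p` (`commute_symOp_up`), which themselves
  commute (`commute_up_up`);
* consequences: the polynomial action `symPolyHom : O[Syms] → End H^i(U(b,c), τ)` (`PolyAction.polyHom`),
  the `U_p`-ordinary part `symOrd = ⋂_{v ∣ p} ⋂ₘ range U_{v,1}^m` and its stability
  (`symPolyHom_apply_mem_symOrd`);
* the memberships in the integral monoid of `SymCoeffLattice` (`heckeElement_mem_integralMonoid`,
  `ofLocal_mem_integralMonoid`, `diamondPi_mem_integralMonoid'`, `goodElements_le_integralMonoid`).

## References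

* C. Khare, J. A. Thorne, *Potential automorphy and the Leopoldt conjecture*, Amer. J. Math. 139
  (2017), §6.2 Lemma 6.5, §6.3, §6.5 (arXiv:1409.7007, held). [KhareThorne2017]
* H. Hida, *p-adic ordinary Hecke algebras for GL(2)*, Ann. Inst. Fourier 44 (1994), §2–§3 (held).
  [Hida1994AIF]
-/

noncomputable section

open CategoryTheory IsDedekindDomain MvPolynomial
open scoped NumberField

universe u

namespace Literature.NumberTheory.Automorphic

/-! ### Generic: local sums and orthogonal places with `ι_v(a) ∈ Δ` only -/

namespace LevelAction

section Orthogonal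

variable {R : Type u} [CommRing R] {𝒢 : Type u} [Group 𝒢] {M : Type u} [AddCommGroup M] [Module R M]
  {Δ : Submonoid 𝒢} {θ : Δ →* Module.End R M} {U : Subgroup 𝒢}
  {Gᵥ : Type*} [Group Gᵥ] {Kᵥ : Subgroup Gᵥ} {ιᵥ : Gᵥ →* 𝒢} {πᵥ : 𝒢 →* Gᵥ}

/-- Representatives of the local cosets in `Kᵥ a Kᵥ` map into `Δ` as soon as `ιᵥ(a) ∈ Δ ⊇ U ⊇ ιᵥ(Kᵥ)`.
[folklore] -/
theorem map_out_mem_of_mem_orbit (h : ArithmeticQuotient.IsUnramifiedLevel Kᵥ ιᵥ πᵥ U)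
    (hU : U.toSubmonoid ≤ Δ) {a : Gᵥ} (ha : ιᵥ a ∈ Δ) {y : Gᵥ ⧸ Kᵥ}
    (hy : y ∈ MulAction.orbit Kᵥ (a : Gᵥ ⧸ Kᵥ)) : ιᵥ y.out ∈ Δ := by
  obtain ⟨κ, rfl⟩ := hy
  obtain ⟨κ', hκ'⟩ := QuotientGroup.mk_out_eq_mul Kᵥ ((κ : Gᵥ) * a)
  change ιᵥ (Quotient.out ((((κ : Gᵥ) * a : Gᵥ) : Gᵥ ⧸ Kᵥ))) ∈ Δ
  rw [hκ', map_mul, map_mul]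
  exact Δ.mul_mem (Δ.mul_mem (hU (h.map_mem κ.2)) ha) (hU (h.map_mem κ'.2))

open scoped Classical in
/-- **The Hecke operator at an unramified place is the local double-coset sum** — the variant of
`heckeOp_apply_eq_sum_local` assuming only `ιᵥ(a) ∈ Δ` (not `ιᵥ(Gᵥ) ⊆ Δ`).
[cite: KhareThorne2017, §6.2] -/
theorem heckeOp_apply_eq_sum_local' (h : ArithmeticQuotient.IsUnramifiedLevel Kᵥ ιᵥ πᵥ U)
    (hU : U.toSubmonoid ≤ Δ) {a : Gᵥ} (haΔ : ιᵥ a ∈ Δ)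
    (ha : (MulAction.orbit Kᵥ (a : Gᵥ ⧸ Kᵥ)).Finite) {m : M} (hm : m ∈ invariants Δ θ U) :
    heckeOp Δ θ U (ιᵥ a) m = ∑ y ∈ ha.toFinset, act Δ θ (ιᵥ y.out) m := by
  have hfin : (ArithmeticQuotient.doubleCosetQuot U (ιᵥ a)).Finite :=
    (h.finite_doubleCosetQuot_iff a).2 ha
  rw [heckeOp_eq_sum hfin, LinearMap.sum_apply]
  symm
  refine Finset.sum_nbij h.localCoset (fun y hy => ?_)
    (fun y _ z _ hyz => h.localCoset_injective hyz) (fun d hd => ?_) (fun y hy => ?_)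
  · rw [Set.Finite.mem_toFinset] at hy ⊢
    exact (h.bijOn_localCoset a).mapsTo hy
  · rw [Finset.mem_coe, Set.Finite.mem_toFinset] at hd
    obtain ⟨y, hy, rfl⟩ := (h.bijOn_localCoset a).surjOn hd
    exact ⟨y, by rwa [Finset.mem_coe, Set.Finite.mem_toFinset], rfl⟩
  · rw [Set.Finite.mem_toFinset] at hy
    refine (act_out_apply_eq hU hm (map_out_mem_of_mem_orbit h hU haΔ hy) _ ?_).symm
    conv_rhs => rw [← QuotientGroup.out_eq' y]
    rw [h.localCoset_mk]

variable {G₁ G₂ : Type*} [Group G₁] [Group G₂] {K₁ : Subgroup G₁} {K₂ : Subgroup G₂}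
  {ι₁ : G₁ →* 𝒢} {π₁ : 𝒢 →* G₁} {ι₂ : G₂ →* 𝒢} {π₂ : 𝒢 →* G₂}

open scoped Classical in
/-- **Hecke operators at two orthogonal unramified places commute on `M^U`** — the variant of
`heckeOp_comm_apply_of_orthogonal` assuming only `ι₁(a), ι₂(b) ∈ Δ`. [cite: KhareThorne2017, §6.2] -/
theorem heckeOp_comm_apply_of_orthogonal' (h₁ : ArithmeticQuotient.IsUnramifiedLevel K₁ ι₁ π₁ U)
    (h₂ : ArithmeticQuotient.IsUnramifiedLevel K₂ ι₂ π₂ U) (hU : U.toSubmonoid ≤ Δ)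
    {a : G₁} {b : G₂} (ha : ι₁ a ∈ Δ) (hb : ι₂ b ∈ Δ) (horth : ∀ y : G₁, π₂ (ι₁ y) = 1)
    {m : M} (hm : m ∈ invariants Δ θ U) :
    heckeOp Δ θ U (ι₁ a) (heckeOp Δ θ U (ι₂ b) m) =
      heckeOp Δ θ U (ι₂ b) (heckeOp Δ θ U (ι₁ a) m) := by
  by_cases hfa : (MulAction.orbit K₁ (a : G₁ ⧸ K₁)).Finite
  swap
  · rw [heckeOp_eq_zero_of_infinite (mt (h₁.finite_doubleCosetQuot_iff a).1 hfa)]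
    simp
  by_cases hfb : (MulAction.orbit K₂ (b : G₂ ⧸ K₂)).Finite
  swap
  · rw [heckeOp_eq_zero_of_infinite (mt (h₂.finite_doubleCosetQuot_iff b).1 hfb)]
    simp
  rw [heckeOp_apply_eq_sum_local' h₁ hU ha hfa (heckeOp_apply_mem hU hb hm),
    heckeOp_apply_eq_sum_local' h₂ hU hb hfb (heckeOp_apply_mem hU ha hm),
    heckeOp_apply_eq_sum_local' h₂ hU hb hfb hm, heckeOp_apply_eq_sum_local' h₁ hU ha hfa hm]
  simp only [map_sum]
  rw [Finset.sum_comm]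
  refine Finset.sum_congr rfl fun z hz => Finset.sum_congr rfl fun y hy => ?_
  rw [Set.Finite.mem_toFinset] at hz hy
  have hyΔ : ι₁ y.out ∈ Δ := map_out_mem_of_mem_orbit h₁ hU ha hy
  have hzΔ : ι₂ z.out ∈ Δ := map_out_mem_of_mem_orbit h₂ hU hb hz
  rw [← Module.End.mul_apply, ← Module.End.mul_apply, ← act_mul hyΔ hzΔ, ← act_mul hzΔ hyΔ,
    h₂.comm_of_apply_eq_one _ (horth y.out) z.out]

end Orthogonal

section Cohomology

variable {R : Type u} [CommRing R] {Γ 𝒢 : Type u} [Group Γ] [Group 𝒢] (ι : Γ →* 𝒢) {Δ : Submonoid 𝒢}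
  {V : Type u} [AddCommGroup V] [Module R V] (τ : Δ →* Module.End R V) {U : Subgroup 𝒢}
  (hU : U.toSubmonoid ≤ Δ)

/-- **`[U z U]` commutes with every `[U α U]` on `H^i(U, τ)` for `z ∈ Δ` central in `𝒢`.** [folklore] -/
theorem heckeCohomology_comm_of_central {z α : 𝒢} (hz : z ∈ Δ) (hzc : ∀ g : 𝒢, g * z = z * g)
    (hα : α ∈ Δ) (i : ℕ) :
    heckeCohomology ι Δ τ U hU hz i * heckeCohomology ι Δ τ U hU hα i =
      heckeCohomology ι Δ τ U hU hα i * heckeCohomology ι Δ τ U hU hz i :=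
  heckeCohomology_comm ι τ hU hz hα (fun _ hf => (heckeOp_comm_apply_of_central hU hz hzc hα hf).symm) i

variable {G₁ G₂ : Type*} [Group G₁] [Group G₂] {K₁ : Subgroup G₁} {K₂ : Subgroup G₂}
  {ι₁ : G₁ →* 𝒢} {π₁ : 𝒢 →* G₁} {ι₂ : G₂ →* 𝒢} {π₂ : 𝒢 →* G₂}

/-- **Operators at two orthogonal unramified places commute on `H^i(U, τ)`** (`ι₁(a), ι₂(b) ∈ Δ`).
[cite: KhareThorne2017, §6.2, Lemma 6.5 (1)] -/
theorem heckeCohomology_comm_of_orthogonal (h₁ : ArithmeticQuotient.IsUnramifiedLevel K₁ ι₁ π₁ U)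
    (h₂ : ArithmeticQuotient.IsUnramifiedLevel K₂ ι₂ π₂ U) {a : G₁} {b : G₂} (ha : ι₁ a ∈ Δ) (hb : ι₂ b ∈ Δ)
    (horth : ∀ y : G₁, π₂ (ι₁ y) = 1) (i : ℕ) :
    heckeCohomology ι Δ τ U hU ha i * heckeCohomology ι Δ τ U hU hb i =
      heckeCohomology ι Δ τ U hU hb i * heckeCohomology ι Δ τ U hU ha i :=
  heckeCohomology_comm ι τ hU ha hb (fun _ hf => heckeOp_comm_apply_of_orthogonal' h₁ h₂ hU ha hb horth hf) i

end Cohomology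

end LevelAction

/-! ### Elements: memberships in the integral monoid, commutation of diagonal elements -/

namespace BigHeckeGLn

open IntegralWeightGL2 LevelAction ParallelWeight

variable {K : Type} [Field K] [NumberField K]

/-- `t_{w,0} = 1`. [folklore] -/
theorem heckeElement_zero_eq_one'' (w : HeightOneSpectrum (𝓞 K)) : heckeElement 2 K w 0 = 1 := by
  have h : (fun k : Fin 2 => if k.val < 0 then uniformizerIdele K w (uniformizerAt w) else 1) = 1 :=
    funext fun k => if_neg (Nat.not_lt_zero _)
  rw [heckeElement, h, map_one]

/-- `t_{w,j} = t_{w,2}` for `j ≥ 2` (`GL₂`). [folklore] -/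
theorem heckeElement_of_two_le (w : HeightOneSpectrum (𝓞 K)) {j : ℕ} (hj : 2 ≤ j) :
    heckeElement 2 K w j = heckeElement 2 K w 2 := by
  unfold heckeElement
  congr 1
  funext k
  rw [if_pos (lt_of_lt_of_le k.isLt hj), if_pos k.isLt]

variable {E : Type} [Field E] (v : (K →+* E) → HeightOneSpectrum (𝓞 K))

/-- **`t_{w,j}` lies in the integral monoid** (every index family `v`). [folklore] -/
theorem heckeElement_mem_integralMonoid (w : HeightOneSpectrum (𝓞 K)) (j : ℕ) :
    heckeElement 2 K w j ∈ integralMonoid K v :=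
  (mem_integralMonoid_iff _).2 fun τ => by
    by_cases h : v τ = w
    · rw [h, heckeElement_eq_ofLocal, localComponent_ofLocal]
      exact glDiagonal_uniformizerAt_mem_integralAt K 2 w j
    · rw [localComponent_heckeElement_of_ne h]
      exact Submonoid.one_mem _

/-- An element supported at a place outside the index places lies in the integral monoid. [folklore] -/
theorem ofLocal_mem_integralMonoid {w : HeightOneSpectrum (𝓞 K)} (hw : ∀ τ, v τ ≠ w)
    (x : GL (Fin 2) (w.adicCompletion K)) : ofLocal 2 K w x ∈ integralMonoid K v :=
  (mem_integralMonoid_iff _).2 fun τ => by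
    rw [localComponent_ofLocal_of_ne (hw τ)]
    exact Submonoid.one_mem _

variable {p : ℕ} [Fact p.Prime]

/-- **The diamonds `diamondPi u` lie in the integral monoid** of any family of places above `p`.
[folklore] -/
theorem diamondPi_mem_integralMonoid' (hv : ∀ τ, (p : 𝓞 K) ∈ (v τ).asIdeal)
    (u : ∀ w : PlacesAbove K p, (Fin 2 → (w.1.adicCompletionIntegers K)ˣ)) :
    diamondPi 2 K p u ∈ integralMonoid K v :=
  (mem_integralMonoid_iff _).2 fun τ i j => by
    rw [localComponent_diamondPi u ⟨v τ, hv τ⟩, coe_glDiagonal, Matrix.diagonal_apply]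
    split_ifs
    · exact SetLike.coe_mem _
    · exact Subring.zero_mem _

/-- `diamondPi u` commutes with every `t_{w,j}` at a place `w` not above `p`. [folklore] -/
theorem diamondPi_mul_heckeElement_of_not_mem (u : ∀ w : PlacesAbove K p, (Fin 2 → (w.1.adicCompletionIntegers K)ˣ))
    {w : HeightOneSpectrum (𝓞 K)} (hw : (p : 𝓞 K) ∉ w.asIdeal) (j : ℕ) :
    diamondPi 2 K p u * heckeElement 2 K w j = heckeElement 2 K w j * diamondPi 2 K p u := by
  rw [heckeElement_eq_ofLocal]
  exact mul_ofLocal_comm (localComponent_diamondPi_of_not_mem u hw) _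

namespace TameLevel

variable (𝒰 : TameLevel 2 K p)

/-- **The good Hecke elements lie in the integral monoid** of any family of places above `p`. [folklore] -/
theorem goodElements_le_integralMonoid {g : FiniteAdelicGL 2 K} (hg : g ∈ 𝒰.goodElements) :
    g ∈ integralMonoid K v := by
  obtain ⟨w, -, j, rfl⟩ := hg
  exact heckeElement_mem_integralMonoid v w j

/-! ### Commutativity on `H^i(U(b,c), τ)` for an arbitrary coefficient system -/

variable {R : Type} [CommRing R] {V : Type} [AddCommGroup V] [Module R V]
  {Δ : Submonoid (FiniteAdelicGL 2 K)} (τ : Δ →* Module.End R V) {b c : ℕ}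
  (hU : (𝒰.level b c).toSubmonoid ≤ Δ)

/-- **Operators at two distinct Hida places commute on `H^i(U(b,c), τ)`** (`U` maximal above `p`;
elements `ofLocal v x`, `ofLocal w y` of `Δ`). [cite: KhareThorne2017, §6.2, Lemma 6.5 (1)] -/
theorem heckeCohomology_level_comm_of_ne (h𝒰 : 𝒰.IsMaximalAbove) {v w : HeightOneSpectrum (𝓞 K)}
    (hv : 𝒰.IsHidaPlace v) (hw : 𝒰.IsHidaPlace w) (hvw : v ≠ w) {x : GL (Fin 2) (v.adicCompletion K)}
    {y : GL (Fin 2) (w.adicCompletion K)} (hx : ofLocal 2 K v x ∈ Δ) (hy : ofLocal 2 K w y ∈ Δ) (i : ℕ) :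
    heckeCohomology (globalEmbedding 2 K) Δ τ (𝒰.level b c) hU hx i *
        heckeCohomology (globalEmbedding 2 K) Δ τ (𝒰.level b c) hU hy i =
      heckeCohomology (globalEmbedding 2 K) Δ τ (𝒰.level b c) hU hy i *
        heckeCohomology (globalEmbedding 2 K) Δ τ (𝒰.level b c) hU hx i := by
  obtain ⟨Kv, hKv⟩ := 𝒰.exists_isUnramifiedLevel_level h𝒰 b c hv
  obtain ⟨Kw, hKw⟩ := 𝒰.exists_isUnramifiedLevel_level h𝒰 b c hw
  exact LevelAction.heckeCohomology_comm_of_orthogonal (globalEmbedding 2 K) τ hU hKv hKw hx hy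
    (fun g => localComponent_ofLocal_of_ne (Ne.symm hvw) g) i

/-- `T(t_{w,j})` commutes with every `[U α U]` when `j = 0` (`t_{w,0} = 1`) or `j ≥ 2` (`t_{w,j}` central).
[folklore] -/
theorem heckeCohomology_level_comm_heckeElement_of_ne_one {w : HeightOneSpectrum (𝓞 K)} {j : ℕ} (hj : j ≠ 1)
    (hwj : heckeElement 2 K w j ∈ Δ) {α : FiniteAdelicGL 2 K} (hα : α ∈ Δ) (i : ℕ) :
    heckeCohomology (globalEmbedding 2 K) Δ τ (𝒰.level b c) hU hwj i *
        heckeCohomology (globalEmbedding 2 K) Δ τ (𝒰.level b c) hU hα i =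
      heckeCohomology (globalEmbedding 2 K) Δ τ (𝒰.level b c) hU hα i *
        heckeCohomology (globalEmbedding 2 K) Δ τ (𝒰.level b c) hU hwj i := by
  rcases Nat.lt_or_ge j 1 with h0 | h1
  · have hj0 : heckeElement 2 K w j = 1 := by
      rw [Nat.lt_one_iff.1 h0]
      exact heckeElement_zero_eq_one'' w
    have h1Δ : (1 : FiniteAdelicGL 2 K) ∈ Δ := Δ.one_mem
    rw [LevelAction.heckeCohomology_congr (globalEmbedding 2 K) Δ τ (𝒰.level b c) hU hwj h1Δ hj0 i,
      LevelAction.heckeCohomology_of_mem_level (globalEmbedding 2 K) Δ τ (𝒰.level b c) hU (one_mem _) i,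
      one_mul, mul_one]
  · have h2 : 2 ≤ j := by omega
    have hj2 : heckeElement 2 K w j = heckeElement 2 K w 2 := heckeElement_of_two_le w h2
    have h2Δ : heckeElement 2 K w 2 ∈ Δ := hj2 ▸ hwj
    rw [LevelAction.heckeCohomology_congr (globalEmbedding 2 K) Δ τ (𝒰.level b c) hU hwj h2Δ hj2 i]
    exact LevelAction.heckeCohomology_comm_of_central (globalEmbedding 2 K) τ hU h2Δ
      (fun g => mul_heckeElement_self_comm K 2 w g) hα i

/-- **`T(t_{w,j})` and `T(t_{w,j'})` commute on `H^i(U(b,c), τ)`.** [cite: KhareThorne2017, §6.2, Lemma 6.5 (1)] -/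
theorem heckeCohomology_level_comm_heckeElement {w : HeightOneSpectrum (𝓞 K)} {j j' : ℕ}
    (hwj : heckeElement 2 K w j ∈ Δ) (hwj' : heckeElement 2 K w j' ∈ Δ) (i : ℕ) :
    heckeCohomology (globalEmbedding 2 K) Δ τ (𝒰.level b c) hU hwj i *
        heckeCohomology (globalEmbedding 2 K) Δ τ (𝒰.level b c) hU hwj' i =
      heckeCohomology (globalEmbedding 2 K) Δ τ (𝒰.level b c) hU hwj' i *
        heckeCohomology (globalEmbedding 2 K) Δ τ (𝒰.level b c) hU hwj i := by
  by_cases hj : j = 1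
  · by_cases hj' : j' = 1
    · subst hj hj'
      rfl
    · exact (𝒰.heckeCohomology_level_comm_heckeElement_of_ne_one τ hU hj' hwj' hwj i).symm
  · exact 𝒰.heckeCohomology_level_comm_heckeElement_of_ne_one τ hU hj hwj hwj' i

/-! ### The operators of the symbols -/

variable (c₀ : ℕ) (hG : ∀ g ∈ 𝒰.goodElements, g ∈ Δ)
  (hD : ∀ u : ∀ w : PlacesAbove K p, (Fin 2 → (w.1.adicCompletionIntegers K)ˣ), diamondPi 2 K p u ∈ Δ)

/-- **The operator family of the symbols on `H^i(U(b,c), τ)`**: `X_g ↦ [U g U]` (`g` good),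
`X_d ↦ [U (torusElement d) U]`. [cite: KhareThorne2017, §6.5] -/
def symOp (i : ℕ) : 𝒰.Syms c₀ → Module.End R (LevelAction.cohomology (globalEmbedding 2 K) Δ τ (𝒰.level b c) i) :=
  Sum.elim (fun g => heckeCohomology (globalEmbedding 2 K) Δ τ (𝒰.level b c) hU (hG g.1 g.2) i)
    (fun d => heckeCohomology (globalEmbedding 2 K) Δ τ (𝒰.level b c) hU (hD d.units) i)

variable {c₀ hG hD}

/-- `symOp` on a good symbol. [folklore] -/
@[simp]
theorem symOp_inl (i : ℕ) (g : 𝒰.goodElements) :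
    𝒰.symOp τ hU c₀ hG hD i (Sum.inl g) = heckeCohomology (globalEmbedding 2 K) Δ τ (𝒰.level b c) hU (hG g.1 g.2) i :=
  rfl

/-- `symOp` on a torus symbol. [folklore] -/
@[simp]
theorem symOp_inr (i : ℕ) (d : TorusDatum K p c₀) :
    𝒰.symOp τ hU c₀ hG hD i (Sum.inr d) = heckeCohomology (globalEmbedding 2 K) Δ τ (𝒰.level b c) hU (hD d.units) i :=
  rfl

/-- A torus operator commutes with `[U α U]` whenever `torusElement d` and `α` commute. [folklore] -/
theorem heckeCohomology_level_comm_torus (h𝒰 : 𝒰.IsMaximalAbove)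
    (u : ∀ w : PlacesAbove K p, (Fin 2 → (w.1.adicCompletionIntegers K)ˣ)) (hu : diamondPi 2 K p u ∈ Δ)
    {α : FiniteAdelicGL 2 K} (hα : α ∈ Δ) (hc : diamondPi 2 K p u * α = α * diamondPi 2 K p u) (i : ℕ) :
    heckeCohomology (globalEmbedding 2 K) Δ τ (𝒰.level b c) hU hu i *
        heckeCohomology (globalEmbedding 2 K) Δ τ (𝒰.level b c) hU hα i =
      heckeCohomology (globalEmbedding 2 K) Δ τ (𝒰.level b c) hU hα i *
        heckeCohomology (globalEmbedding 2 K) Δ τ (𝒰.level b c) hU hu i :=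
  LevelAction.heckeCohomology_comm_of_normalizing (globalEmbedding 2 K) Δ τ (𝒰.level b c) hU hu hα
    (fun x hx => 𝒰.diamondPi_conj_mem_level h𝒰 b c u hx)
    (fun x hx => by
      have h := 𝒰.diamondPi_conj_mem_level h𝒰 b c u⁻¹ hx
      rwa [map_inv, inv_inv] at h)
    hc i

/-- **The operators of the symbols pairwise commute on `H^i(U(b,c), τ)`.**
[cite: KhareThorne2017, §6.2, Lemma 6.5 (1)] -/
theorem symOp_comm (h𝒰 : 𝒰.IsMaximalAbove) (i : ℕ) (a a' : 𝒰.Syms c₀) :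
    Commute (𝒰.symOp τ hU c₀ hG hD i a) (𝒰.symOp τ hU c₀ hG hD i a') := by
  rcases a with ⟨g, w, hw, j, rfl⟩ | d <;> rcases a' with ⟨g', w', hw', j', rfl⟩ | d'
  · -- two good Hecke elements
    by_cases hww' : w = w'
    · subst hww'
      exact 𝒰.heckeCohomology_level_comm_heckeElement τ hU _ _ i
    · change _ * _ = _ * _
      have hx := hG _ (𝒰.heckeElement_mem_goodElements hw j)
      have hy := hG _ (𝒰.heckeElement_mem_goodElements hw' j')
      rw [heckeElement_eq_ofLocal] at hx hy
      have h := 𝒰.heckeCohomology_level_comm_of_ne τ hU h𝒰 (Or.inl hw) (Or.inl hw') hww' hx hy i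
      simp only [symOp_inl]
      rw [LevelAction.heckeCohomology_congr (globalEmbedding 2 K) Δ τ (𝒰.level b c) hU
          (hG _ (𝒰.heckeElement_mem_goodElements hw j)) hx (heckeElement_eq_ofLocal w j) i,
        LevelAction.heckeCohomology_congr (globalEmbedding 2 K) Δ τ (𝒰.level b c) hU
          (hG _ (𝒰.heckeElement_mem_goodElements hw' j')) hy (heckeElement_eq_ofLocal w' j') i]
      exact h
  · exact (𝒰.heckeCohomology_level_comm_torus τ hU h𝒰 d'.units (hD d'.units) (hG _ (𝒰.heckeElement_mem_goodElements hw j))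
      (diamondPi_mul_heckeElement_of_not_mem d'.units (not_mem_asIdeal_of_not_mem_bad hw) j) i).symm
  · exact 𝒰.heckeCohomology_level_comm_torus τ hU h𝒰 d.units (hD d.units) (hG _ (𝒰.heckeElement_mem_goodElements hw' j'))
      (diamondPi_mul_heckeElement_of_not_mem d.units (not_mem_asIdeal_of_not_mem_bad hw') j') i
  · refine 𝒰.heckeCohomology_level_comm_torus τ hU h𝒰 d.units (hD d.units) (hD d'.units) ?_ i
    rw [← map_mul, ← map_mul, mul_comm]

variable (hUp : ∀ w : PlacesAbove K p, heckeElement 2 K w.1 1 ∈ Δ)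

/-- **The operators of the symbols commute with every `U_{v,1}`, `v ∣ p`.** [cite: KhareThorne2017, §6.2, Lemma 6.5 (1)] -/
theorem commute_symOp_up (h𝒰 : 𝒰.IsMaximalAbove) (i : ℕ) (a : 𝒰.Syms c₀) (w : PlacesAbove K p) :
    Commute (𝒰.symOp τ hU c₀ hG hD i a) (heckeCohomology (globalEmbedding 2 K) Δ τ (𝒰.level b c) hU (hUp w) i) := by
  rcases a with ⟨g, w', hw', j, rfl⟩ | d
  · change _ * _ = _ * _
    have hne : w' ≠ w.1 := fun h => not_mem_asIdeal_of_not_mem_bad hw' (h ▸ w.2)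
    have hx := hG _ (𝒰.heckeElement_mem_goodElements hw' j)
    have hy := hUp w
    rw [heckeElement_eq_ofLocal] at hx hy
    have h := 𝒰.heckeCohomology_level_comm_of_ne τ hU h𝒰 (Or.inl hw') (Or.inr w.2) hne hx hy i
    simp only [symOp_inl]
    rw [LevelAction.heckeCohomology_congr (globalEmbedding 2 K) Δ τ (𝒰.level b c) hU
        (hG _ (𝒰.heckeElement_mem_goodElements hw' j)) hx (heckeElement_eq_ofLocal w' j) i,
      LevelAction.heckeCohomology_congr (globalEmbedding 2 K) Δ τ (𝒰.level b c) hU (hUp w) hy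
        (heckeElement_eq_ofLocal w.1 1) i]
    exact h
  · refine 𝒰.heckeCohomology_level_comm_torus τ hU h𝒰 d.units (hD d.units) (hUp w) ?_ i
    simpa only [pow_one] using (commute_diamondPi_heckeElement_pow (p := p) d.units w.1 1).eq

/-- **The `U_{v,1}`, `v ∣ p`, pairwise commute on `H^i(U(b,c), τ)`.** [cite: KhareThorne2017, §6.2, Lemma 6.5 (1)] -/
theorem commute_up_up (h𝒰 : 𝒰.IsMaximalAbove) (i : ℕ) (w w' : PlacesAbove K p) :
    Commute (heckeCohomology (globalEmbedding 2 K) Δ τ (𝒰.level b c) hU (hUp w) i)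
      (heckeCohomology (globalEmbedding 2 K) Δ τ (𝒰.level b c) hU (hUp w') i) := by
  by_cases hww' : w = w'
  · subst hww'
    exact Commute.refl _
  · change _ * _ = _ * _
    have hne : w.1 ≠ w'.1 := fun h => hww' (Subtype.ext h)
    have hx := hUp w
    have hy := hUp w'
    rw [heckeElement_eq_ofLocal] at hx hy
    have h := 𝒰.heckeCohomology_level_comm_of_ne τ hU h𝒰 (Or.inr w.2) (Or.inr w'.2) hne hx hy i
    rw [LevelAction.heckeCohomology_congr (globalEmbedding 2 K) Δ τ (𝒰.level b c) hU (hUp w) hx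
        (heckeElement_eq_ofLocal w.1 1) i,
      LevelAction.heckeCohomology_congr (globalEmbedding 2 K) Δ τ (𝒰.level b c) hU (hUp w') hy
        (heckeElement_eq_ofLocal w'.1 1) i]
    exact h

/-! ### The polynomial action of `O[Syms]` and the `U_p`-ordinary part -/

variable (c₀ hG hD) {O : Type} [CommRing O] (φ : O →+* R)

/-- **`π : O[Syms] → End H^i(U(b,c), τ)`**, the polynomial action of the symbol ring (`PolyAction.polyHom`
of the commuting family `symOp`, scalars through `φ : O → R`). [cite: KhareThorne2017, §6.5] -/
def symPolyHom (h𝒰 : 𝒰.IsMaximalAbove) (i : ℕ) :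
    MvPolynomial (𝒰.Syms c₀) O →+* Module.End R (LevelAction.cohomology (globalEmbedding 2 K) Δ τ (𝒰.level b c) i) :=
  PolyAction.polyHom φ (𝒰.symOp τ hU c₀ hG hD i) (𝒰.symOp_comm τ hU h𝒰 i)

/-- `π(X_a) = symOp a`. [folklore] -/
@[simp]
theorem symPolyHom_X (h𝒰 : 𝒰.IsMaximalAbove) (i : ℕ) (a : 𝒰.Syms c₀) :
    𝒰.symPolyHom τ hU c₀ hG hD φ h𝒰 i (X a) = 𝒰.symOp τ hU c₀ hG hD i a :=
  PolyAction.polyHom_X _ a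

/-- `π(C o) m = φ o • m`. [folklore] -/
theorem symPolyHom_C_apply (h𝒰 : 𝒰.IsMaximalAbove) (i : ℕ) (o : O)
    (m : LevelAction.cohomology (globalEmbedding 2 K) Δ τ (𝒰.level b c) i) :
    𝒰.symPolyHom τ hU c₀ hG hD φ h𝒰 i (C o) m = φ o • m :=
  PolyAction.polyHom_C_apply _ o m

/-- **The `U_p`-ordinary part `⋂_{v ∣ p} ⋂ₘ range U_{v,1}^m` of `H^i(U(b,c), τ)`.**
[cite: KhareThorne2017, §2.4, Lemma 2.10; §6.4] -/
def symOrd (i : ℕ) : Submodule R (LevelAction.cohomology (globalEmbedding 2 K) Δ τ (𝒰.level b c) i) :=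
  ⨅ (w : PlacesAbove K p) (m : ℕ), LinearMap.range (heckeCohomology (globalEmbedding 2 K) Δ τ (𝒰.level b c) hU (hUp w) i ^ m)

variable {c₀ hG hD hUp}

/-- Membership in `symOrd`. [folklore] -/
theorem mem_symOrd_iff (i : ℕ) (x : LevelAction.cohomology (globalEmbedding 2 K) Δ τ (𝒰.level b c) i) :
    x ∈ 𝒰.symOrd τ hU hUp i ↔
      ∀ w : PlacesAbove K p, x ∈ ⨅ m : ℕ, LinearMap.range (heckeCohomology (globalEmbedding 2 K) Δ τ (𝒰.level b c) hU (hUp w) i ^ m) := by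
  rw [symOrd, Submodule.mem_iInf]

/-- **The operators of the symbols preserve the `U_p`-ordinary part.** [cite: KhareThorne2017, §6.3] -/
theorem symOp_apply_mem_symOrd (h𝒰 : 𝒰.IsMaximalAbove) (i : ℕ) (a : 𝒰.Syms c₀)
    {x : LevelAction.cohomology (globalEmbedding 2 K) Δ τ (𝒰.level b c) i} (hx : x ∈ 𝒰.symOrd τ hU hUp i) :
    𝒰.symOp τ hU c₀ hG hD i a x ∈ 𝒰.symOrd τ hU hUp i := by
  rw [mem_symOrd_iff] at hx ⊢
  intro w
  exact mapsTo_iInf_range_pow_of_comp_eq (𝒰.commute_symOp_up τ hU hUp h𝒰 i a w).eq (hx w)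

/-- **`π(z)` preserves the `U_p`-ordinary part** for every `z ∈ O[Syms]`. [cite: KhareThorne2017, §6.3] -/
theorem symPolyHom_apply_mem_symOrd (h𝒰 : 𝒰.IsMaximalAbove) (i : ℕ) (z : MvPolynomial (𝒰.Syms c₀) O)
    {x : LevelAction.cohomology (globalEmbedding 2 K) Δ τ (𝒰.level b c) i} (hx : x ∈ 𝒰.symOrd τ hU hUp i) :
    𝒰.symPolyHom τ hU c₀ hG hD φ h𝒰 i z x ∈ 𝒰.symOrd τ hU hUp i :=
  PolyAction.polyHom_apply_mem (𝒰.symOp_comm τ hU h𝒰 i) _ (fun a _ hm => 𝒰.symOp_apply_mem_symOrd τ hU h𝒰 i a hm) z hx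

/-- Every `U_{v,1}` commutes with every `π(z)`. [folklore] -/
theorem commute_up_symPolyHom (h𝒰 : 𝒰.IsMaximalAbove) (i : ℕ) (w : PlacesAbove K p) (z : MvPolynomial (𝒰.Syms c₀) O) :
    Commute (heckeCohomology (globalEmbedding 2 K) Δ τ (𝒰.level b c) hU (hUp w) i)
      (𝒰.symPolyHom τ hU c₀ hG hD φ h𝒰 i z) := by
  induction z using MvPolynomial.induction_on with
  | C o =>
    refine LinearMap.ext fun m => ?_
    change heckeCohomology _ _ _ _ _ _ i (𝒰.symPolyHom τ hU c₀ hG hD φ h𝒰 i (C o) m) =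
      𝒰.symPolyHom τ hU c₀ hG hD φ h𝒰 i (C o) (heckeCohomology _ _ _ _ _ _ i m)
    rw [symPolyHom_C_apply, symPolyHom_C_apply, map_smul]
  | add p q hp hq =>
    rw [map_add]
    exact hp.add_right hq
  | mul_X q a hq =>
    rw [map_mul, symPolyHom_X]
    exact hq.mul_right (𝒰.commute_symOp_up τ hU hUp h𝒰 i a w).symm

end TameLevel

end BigHeckeGLn

end Literature.NumberTheory.Automorphic
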